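import Mathlib.Analysis.SpecialFunctions.NonIntegrable
import Literature.Analysis.FluidPDE.SobolevWeakGradient
import Literature.Analysis.FluidPDE.LerayHopf
import HarnessLib

/-!
# Energy cores of a Leray–Hopf solution: the enstrophy window `2β - γ < 1`

Negative-lane support for `Summit.NavierStokesRegularity.NavierStokesRegularity.Theses.TypeILiouville.TypeIliouvilleNoTypeII`
(item `stmt-NavierStokesRegularity-0056`): a constraint on the **power-law concentration
scenarios** ("energy cores") against which energy-level no-atom statements are aimed
(K-READ 05 of the §B candidate `NoEnergyAtom`; the registered stub
`Cruxes/WeakLambdaCriterion/Lines/birth.lean::stub_noEnergyAtom`). An *energy core* of exponents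
`(β, γ)` at `(T, x₀)` is a speed floor `‖u(t,y)‖ ≥ c (T-t)^{-β}` on the balls
`B(x₀, c (T-t)^γ)` for all `t ∈ [t₀, T)`.

* `ofReal_sq_mul_le_lintegral_frobeniusNormSq` — the **capacity bound**: if `‖u‖ ≥ M` on a ball
  of radius `ρ` and `u ∈ L²` has the weak gradient `G`, then
  `M² ρ |B₁|^{1/3} ≤ K² ∫ |G|²` (`H¹ ⊂ L⁶`, tree `eLpNorm_six_le_lintegral_frobeniusNormSq_weakGradient`,
  and Chebyshev on the ball).
* `lintegral_rpow_neg_eq_top` — `∫_{t₁}^{T} C (T-t)^{-q} dt = ∞` for `q ≥ 1`, `C > 0`.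
* `two_mul_sub_lt_one_of_energyCore` — **for a Leray–Hopf solution (`IsLerayHopfOn`, any
  viscosity parameter) an energy core forces `2β - γ < 1`**: the capacity bound gives
  `∫|∇u(t)|² ≳ c³ (T-t)^{γ-2β}` for a.e. `t ∈ (t₀, T)`, and the Leray–Hopf class has
  `∫₀ᵀ∫|∇u|² < ∞`.
* `two_mul_le_three_mul_of_energyCore` — the **energy side**: an energy core forces `2β ≤ 3γ`
  (`∫|u(t)|² ≥ c⁵ |B₁| (T-t)^{3γ-2β}` against the Leray–Hopf bound `u ∈ L^∞(0,T; L²)`); so on the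
  side `3γ ≤ 2β` only the energy-critical line `γ = 2β/3` carries cores
  (`three_mul_eq_two_mul_of_energyCore`).
* `lt_three_quarters_of_energyCore` — on the energy-admissible side `3γ ≤ 2β` (the hypothesis of
  the candidate's proved `hkill`; cores with `3γ < 2β` carry unbounded energy, those with
  `3γ = 2β` are the energy-critical ones) this reads **`β < 3/4`**: together with the printed
  no-atom theorem below the rate `3/5` (Leslie–Shvydkoy 2018, Prop. 3.2/4.2) the live window of
  energy-carrying cores is `β ∈ [3/5, 3/4)`.

No Navier–Stokes dynamics is used beyond membership in the Leray–Hopf class (finite dissipation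
and `L²` slices). [folklore]
-/

noncomputable section

open Set Function Filter Topology Metric MeasureTheory Module
open scoped InnerProductSpace RealInnerProductSpace ENNReal NNReal

set_option linter.dupNamespace false

namespace Summit.NavierStokesRegularity.NavierStokesRegularity.Theorems.TypeIliouvilleNoTypeIINegative

open Literature.Analysis.FluidPDE

/-- **Capacity bound.** If `u ∈ L²(ℝ³)` has the weak gradient `G` and `‖u‖ ≥ M ≥ 0` on the ball
`B(x₀, ρ)`, then `M² ρ |B(0,1)|^{1/3} ≤ K² ∫ |G|²_F`, `K` the Sobolev constant of `H¹ ⊂ L⁶`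
(Chebyshev: `M⁶ |B(x₀,ρ)| ≤ ‖u‖₆⁶ ≤ K⁶ (∫|G|²)³`, and `|B(x₀,ρ)| = ρ³|B(0,1)|`). [folklore] -/
theorem ofReal_sq_mul_le_lintegral_frobeniusNormSq
    {u : EuclideanSpace ℝ (Fin 3) → EuclideanSpace ℝ (Fin 3)}
    {G : EuclideanSpace ℝ (Fin 3) → EuclideanSpace ℝ (Fin 3) →L[ℝ] EuclideanSpace ℝ (Fin 3)}
    (hw : HasWeakGradient u G) (hu : MemLp u 2 volume) {M ρ : ℝ} (hM : 0 ≤ M) (hρ : 0 ≤ ρ)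
    {x₀ : EuclideanSpace ℝ (Fin 3)} (hcore : ∀ y ∈ ball x₀ ρ, M ≤ ‖u y‖) :
    ENNReal.ofReal (M ^ 2 * ρ) * volume (ball (0 : EuclideanSpace ℝ (Fin 3)) 1) ^ (1 / 3 : ℝ) ≤
      (SNormLESNormFDerivOfEqConst (EuclideanSpace ℝ (Fin 3))
          (volume : Measure (EuclideanSpace ℝ (Fin 3))) 2 : ℝ≥0∞) ^ 2 *
        ∫⁻ x, ENNReal.ofReal (frobeniusNormSq (G x)) := by
  set K : ℝ≥0∞ := (SNormLESNormFDerivOfEqConst (EuclideanSpace ℝ (Fin 3))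
    (volume : Measure (EuclideanSpace ℝ (Fin 3))) 2 : ℝ≥0∞) with hK
  set D : ℝ≥0∞ := ∫⁻ x, ENNReal.ofReal (frobeniusNormSq (G x)) with hD
  -- Sobolev `H¹ ⊂ L⁶`
  have hS : eLpNorm u 6 volume ≤ K * D ^ (1 / 2 : ℝ) :=
    eLpNorm_six_le_lintegral_frobeniusNormSq_weakGradient finrank_euclideanSpace_fin hw
      hu.eLpNorm_lt_top
  -- Chebyshev on the ball
  have hC := mul_meas_ge_le_pow_eLpNorm' (μ := (volume : Measure (EuclideanSpace ℝ (Fin 3))))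
    (p := (6 : ℝ≥0∞)) (by norm_num) (by norm_num) hu.1 (ENNReal.ofReal M)
  have h6 : (6 : ℝ≥0∞).toReal = 6 := by norm_num
  rw [h6] at hC
  have hball : ball x₀ ρ ⊆ {x | ENNReal.ofReal M ≤ ‖u x‖ₑ} := fun y hy => by
    rw [mem_setOf_eq, ← ofReal_norm]
    exact ENNReal.ofReal_le_ofReal (hcore y hy)
  have hA : ENNReal.ofReal M ^ (6 : ℝ) * volume (ball x₀ ρ) ≤ K ^ (6 : ℝ) * D ^ (3 : ℝ) :=
    calc ENNReal.ofReal M ^ (6 : ℝ) * volume (ball x₀ ρ)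
        ≤ ENNReal.ofReal M ^ (6 : ℝ) * volume {x | ENNReal.ofReal M ≤ ‖u x‖ₑ} := by
          gcongr
      _ ≤ eLpNorm u 6 volume ^ (6 : ℝ) := hC
      _ ≤ (K * D ^ (1 / 2 : ℝ)) ^ (6 : ℝ) := ENNReal.rpow_le_rpow hS (by norm_num)
      _ = K ^ (6 : ℝ) * D ^ (3 : ℝ) := by
          rw [ENNReal.mul_rpow_of_nonneg _ _ (by norm_num), ← ENNReal.rpow_mul]
          norm_num
  -- cube roots
  have hA3 := ENNReal.rpow_le_rpow hA (show (0 : ℝ) ≤ 1 / 3 by norm_num)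
  rw [ENNReal.mul_rpow_of_nonneg _ _ (by norm_num : (0 : ℝ) ≤ 1 / 3),
    ENNReal.mul_rpow_of_nonneg _ _ (by norm_num : (0 : ℝ) ≤ 1 / 3), ← ENNReal.rpow_mul,
    ← ENNReal.rpow_mul, ← ENNReal.rpow_mul, show (6 : ℝ) * (1 / 3) = 2 by norm_num,
    show (3 : ℝ) * (1 / 3) = 1 by norm_num, ENNReal.rpow_one, ENNReal.rpow_two, ENNReal.rpow_two,
    ← ENNReal.ofReal_pow hM] at hA3
  -- the volume of the ball
  have hvol : volume (ball x₀ ρ) =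
      ENNReal.ofReal (ρ ^ 3) * volume (ball (0 : EuclideanSpace ℝ (Fin 3)) 1) := by
    rw [Measure.addHaar_ball volume x₀ hρ, finrank_euclideanSpace_fin]
  have hρ3 : ENNReal.ofReal (ρ ^ 3) ^ (1 / 3 : ℝ) = ENNReal.ofReal ρ := by
    rw [ENNReal.ofReal_rpow_of_nonneg (pow_nonneg hρ 3) (by norm_num),
      show (1 / 3 : ℝ) = ((3 : ℕ) : ℝ)⁻¹ by norm_num, Real.pow_rpow_inv_natCast hρ three_ne_zero]
  rw [hvol, ENNReal.mul_rpow_of_nonneg _ _ (by norm_num : (0 : ℝ) ≤ 1 / 3), hρ3, ← mul_assoc,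
    ← ENNReal.ofReal_mul (sq_nonneg M)] at hA3
  exact hA3

/-- `∫_{t₁}^{T} C (T - t)^{-q} dt = ∞` for `q ≥ 1`, `C > 0`, `t₁ < T` (as a lower Lebesgue
integral of `ofReal`): comparison with `(T - t)⁻¹` on `(max t₁ (T-1), T)`, which is not integrable
at `T` (`intervalIntegrable_sub_inv_iff`). [folklore] -/
theorem lintegral_rpow_neg_eq_top {t₁ T q C : ℝ} (ht : t₁ < T) (hq : 1 ≤ q) (hC : 0 < C) :
    ∫⁻ t in Ioo t₁ T, ENNReal.ofReal (C * (T - t) ^ (-q)) = ∞ := by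
  by_contra hne
  have hmeas : Measurable fun t : ℝ => C * (T - t) ^ (-q) :=
    measurable_const.mul ((measurable_const.sub measurable_id).pow_const _)
  have hnn : 0 ≤ᵐ[volume.restrict (Ioo t₁ T)] fun t : ℝ => C * (T - t) ^ (-q) := by
    filter_upwards [ae_restrict_mem measurableSet_Ioo] with t ht'
    exact mul_nonneg hC.le (Real.rpow_nonneg (sub_pos.2 ht'.2).le _)
  have hint : IntegrableOn (fun t : ℝ => C * (T - t) ^ (-q)) (Ioo t₁ T) volume :=
    (lintegral_ofReal_ne_top_iff_integrable hmeas.aestronglyMeasurable hnn).1 hne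
  -- restrict to `(t₂, T)`, `t₂ = max t₁ (T - 1)`, where `(T - t)⁻¹ ≤ (T - t)^{-q}`
  set t₂ : ℝ := max t₁ (T - 1) with ht₂
  have ht₂T : t₂ < T := max_lt ht (by linarith)
  have hsub : Ioo t₂ T ⊆ Ioo t₁ T := Ioo_subset_Ioo_left (le_max_left _ _)
  have hint₂ : IntegrableOn (fun t : ℝ => C⁻¹ * (C * (T - t) ^ (-q))) (Ioo t₂ T) volume :=
    (hint.mono_set hsub).const_mul C⁻¹
  have hdom : IntegrableOn (fun t : ℝ => (t - T)⁻¹) (Ioo t₂ T) volume := by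
    refine Integrable.mono' hint₂
      ((measurable_id.sub measurable_const).inv.aestronglyMeasurable) ?_
    filter_upwards [ae_restrict_mem measurableSet_Ioo] with t ht'
    have hTt : 0 < T - t := sub_pos.2 ht'.2
    have hTt1 : T - t ≤ 1 := by
      have : T - 1 ≤ t₂ := le_max_right _ _
      linarith [ht'.1]
    rw [inv_mul_cancel_left₀ hC.ne', Real.norm_eq_abs, show t - T = -(T - t) by ring, inv_neg,
      abs_neg, abs_of_pos (inv_pos.2 hTt), ← Real.rpow_neg_one]
    exact Real.rpow_le_rpow_of_exponent_ge hTt hTt1 (by linarith)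
  have hII : IntervalIntegrable (fun t : ℝ => (t - T)⁻¹) volume t₂ T :=
    (intervalIntegrable_iff_integrableOn_Ioo_of_le ht₂T.le).2 hdom
  rcases intervalIntegrable_sub_inv_iff.1 hII with h | h
  · exact ht₂T.ne h
  · exact h right_mem_uIcc

/-- **Energy cores of a Leray–Hopf solution satisfy `2β - γ < 1`.** If `u` is a Leray–Hopf weak
solution on `[0, T)` (`IsLerayHopfOn T ν 0 u₀ u`: `L²` slices, a weak gradient `G(t)` for a.e.
`t` with `∫₀ᵀ ∫ |G|²_F < ∞`) and, for some `c > 0`, `0 ≤ t₀ < T`, `x₀`,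
`‖u(t, y)‖ ≥ c (T - t)^{-β}` for all `t ∈ [t₀, T)` and `y ∈ B(x₀, c (T - t)^γ)`, then
`2β - γ < 1`: otherwise the capacity bound `∫|G(t)|² ≥ K⁻² |B₁|^{1/3} c³ (T - t)^{γ - 2β}`
(a.e. `t ∈ (t₀, T)`) is not integrable up to `T`. [folklore] -/
theorem two_mul_sub_lt_one_of_energyCore {T ν : ℝ}
    {u₀ : EuclideanSpace ℝ (Fin 3) → EuclideanSpace ℝ (Fin 3)}
    {u : ℝ → EuclideanSpace ℝ (Fin 3) → EuclideanSpace ℝ (Fin 3)} (hLH : IsLerayHopfOn T ν 0 u₀ u)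
    {β γ c t₀ : ℝ} {x₀ : EuclideanSpace ℝ (Fin 3)} (hc : 0 < c) (ht₀ : 0 ≤ t₀) (ht₀T : t₀ < T)
    (hcore : ∀ t ∈ Ico t₀ T, ∀ y ∈ ball x₀ (c * (T - t) ^ γ), c * (T - t) ^ (-β) ≤ ‖u t y‖) :
    2 * β - γ < 1 := by
  by_contra hq
  rw [not_lt] at hq
  obtain ⟨G, hG, hfin, -, -⟩ := hLH.weakGrad_energy
  set K : ℝ≥0∞ := (SNormLESNormFDerivOfEqConst (EuclideanSpace ℝ (Fin 3))
    (volume : Measure (EuclideanSpace ℝ (Fin 3))) 2 : ℝ≥0∞) with hK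
  set V₁ : ℝ≥0∞ := volume (ball (0 : EuclideanSpace ℝ (Fin 3)) 1) with hV₁
  have hV₁0 : V₁ ≠ 0 := (measure_ball_pos volume (0 : EuclideanSpace ℝ (Fin 3)) one_pos).ne'
  have hV₁top : V₁ ≠ ∞ := measure_ball_lt_top.ne
  -- the capacity bound for a.e. `t ∈ (t₀, T)`
  have hae : ∀ᵐ t ∂(volume.restrict (Ioo t₀ T)),
      ENNReal.ofReal (c ^ 3 * (T - t) ^ (-(2 * β - γ))) * V₁ ^ (1 / 3 : ℝ) ≤
        K ^ 2 * ∫⁻ x, ENNReal.ofReal (frobeniusNormSq (G t x)) := by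
    have h1 : ∀ᵐ t ∂(volume.restrict (Ioo t₀ T)), HasWeakGradient (u t) (G t) :=
      ae_restrict_of_ae_restrict_of_subset (Ioo_subset_Ioo_left ht₀) hG
    filter_upwards [h1, ae_restrict_mem measurableSet_Ioo] with t hw ht
    have hTt : 0 < T - t := sub_pos.2 ht.2
    have key := ofReal_sq_mul_le_lintegral_frobeniusNormSq hw
      (hLH.memLp t ⟨ht₀.trans ht.1.le, ht.2.le⟩) (M := c * (T - t) ^ (-β)) (ρ := c * (T - t) ^ γ)
      (by positivity) (by positivity) (hcore t ⟨ht.1.le, ht.2⟩)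
    have e : (c * (T - t) ^ (-β)) ^ 2 * (c * (T - t) ^ γ) = c ^ 3 * (T - t) ^ (-(2 * β - γ)) := by
      rw [show -(2 * β - γ) = -β + -β + γ by ring, Real.rpow_add hTt, Real.rpow_add hTt]
      ring
    rwa [e] at key
  -- integrate in time
  have hle : ∫⁻ t in Ioo t₀ T, ENNReal.ofReal (c ^ 3 * (T - t) ^ (-(2 * β - γ))) * V₁ ^ (1 / 3 : ℝ) ≤
      K ^ 2 * ∫⁻ t in Ioo 0 T, ∫⁻ x, ENNReal.ofReal (frobeniusNormSq (G t x)) :=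
    calc ∫⁻ t in Ioo t₀ T, ENNReal.ofReal (c ^ 3 * (T - t) ^ (-(2 * β - γ))) * V₁ ^ (1 / 3 : ℝ)
        ≤ ∫⁻ t in Ioo t₀ T, K ^ 2 * ∫⁻ x, ENNReal.ofReal (frobeniusNormSq (G t x)) :=
          lintegral_mono_ae hae
      _ = K ^ 2 * ∫⁻ t in Ioo t₀ T, ∫⁻ x, ENNReal.ofReal (frobeniusNormSq (G t x)) :=
          lintegral_const_mul' _ _ (by simp [hK])
      _ ≤ K ^ 2 * ∫⁻ t in Ioo 0 T, ∫⁻ x, ENNReal.ofReal (frobeniusNormSq (G t x)) := by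
          gcongr ?_ * ?_
          · exact le_rfl
          · exact lintegral_mono_set (Ioo_subset_Ioo_left ht₀)
  have htop : ∫⁻ t in Ioo t₀ T, ENNReal.ofReal (c ^ 3 * (T - t) ^ (-(2 * β - γ))) * V₁ ^ (1 / 3 : ℝ) = ∞ := by
    rw [lintegral_mul_const' _ _ (ENNReal.rpow_ne_top_of_nonneg (by norm_num) hV₁top),
      lintegral_rpow_neg_eq_top ht₀T hq (pow_pos hc 3)]
    exact ENNReal.top_mul (by simp [ENNReal.rpow_eq_zero_iff, hV₁0, hV₁top])
  have hlt : K ^ 2 * ∫⁻ t in Ioo 0 T, ∫⁻ x, ENNReal.ofReal (frobeniusNormSq (G t x)) < ∞ :=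
    ENNReal.mul_lt_top (by simp [hK]) hfin
  exact (lt_irrefl ∞) ((htop ▸ hle).trans_lt hlt)

/-- **On the energy-admissible side `3γ ≤ 2β` an energy core has `β < 3/4`.** (`3γ ≤ 2β` is the
hypothesis of the candidate's `hkill`/`not_energyCore_of_noAtomAt`; with `2β - γ < 1` it gives
`4β/3 ≤ 2β - γ < 1`.) [folklore] -/
theorem lt_three_quarters_of_energyCore {T ν : ℝ}
    {u₀ : EuclideanSpace ℝ (Fin 3) → EuclideanSpace ℝ (Fin 3)}
    {u : ℝ → EuclideanSpace ℝ (Fin 3) → EuclideanSpace ℝ (Fin 3)} (hLH : IsLerayHopfOn T ν 0 u₀ u)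
    {β γ c t₀ : ℝ} {x₀ : EuclideanSpace ℝ (Fin 3)} (hc : 0 < c) (ht₀ : 0 ≤ t₀) (ht₀T : t₀ < T)
    (hβγ : 3 * γ ≤ 2 * β)
    (hcore : ∀ t ∈ Ico t₀ T, ∀ y ∈ ball x₀ (c * (T - t) ^ γ), c * (T - t) ^ (-β) ≤ ‖u t y‖) :
    β < 3 / 4 := by
  have h := two_mul_sub_lt_one_of_energyCore hLH hc ht₀ ht₀T hcore
  linarith

/-- **Energy side: energy cores of a Leray–Hopf solution satisfy `2β ≤ 3γ`.** The slice energy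
`∫ ‖u(t)‖² ≥ (c (T-t)^{-β})² |B(x₀, c (T-t)^γ)| = c⁵ |B(0,1)| (T-t)^{3γ-2β}` would be unbounded as
`t ↑ T` if `3γ < 2β`, against the Leray–Hopf bound `∫‖u(t)‖² ≤ C` for a.e. `t ∈ (0, T)`
(field `energy_bound`). [folklore] -/
theorem two_mul_le_three_mul_of_energyCore {T ν : ℝ}
    {u₀ : EuclideanSpace ℝ (Fin 3) → EuclideanSpace ℝ (Fin 3)}
    {u : ℝ → EuclideanSpace ℝ (Fin 3) → EuclideanSpace ℝ (Fin 3)} (hLH : IsLerayHopfOn T ν 0 u₀ u)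
    {β γ c t₀ : ℝ} {x₀ : EuclideanSpace ℝ (Fin 3)} (hc : 0 < c) (ht₀ : 0 ≤ t₀) (ht₀T : t₀ < T)
    (hcore : ∀ t ∈ Ico t₀ T, ∀ y ∈ ball x₀ (c * (T - t) ^ γ), c * (T - t) ^ (-β) ≤ ‖u t y‖) :
    2 * β ≤ 3 * γ := by
  by_contra hq
  rw [not_le] at hq
  obtain ⟨C, hCae⟩ := hLH.energy_bound
  set V₁ : ℝ≥0∞ := volume (ball (0 : EuclideanSpace ℝ (Fin 3)) 1) with hV₁
  have hV₁0 : V₁ ≠ 0 := (measure_ball_pos volume (0 : EuclideanSpace ℝ (Fin 3)) one_pos).ne'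
  have hV₁top : V₁ ≠ ∞ := measure_ball_lt_top.ne
  -- the slice energy on the core ball, for every `t ∈ [t₀, T)`
  have hlow : ∀ t ∈ Ico t₀ T,
      ENNReal.ofReal (c ^ 5 * (T - t) ^ (3 * γ - 2 * β)) * V₁ ≤ eEnergy (u t) := by
    intro t ht
    have hTt : 0 < T - t := sub_pos.2 ht.2
    have hM : 0 ≤ c * (T - t) ^ (-β) := by positivity
    have hρ : 0 ≤ c * (T - t) ^ γ := by positivity
    have hvol : volume (ball x₀ (c * (T - t) ^ γ)) = ENNReal.ofReal ((c * (T - t) ^ γ) ^ 3) * V₁ := by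
      rw [Measure.addHaar_ball volume x₀ hρ, finrank_euclideanSpace_fin]
    have e : c ^ 5 * (T - t) ^ (3 * γ - 2 * β) = (c * (T - t) ^ (-β)) ^ 2 * (c * (T - t) ^ γ) ^ 3 := by
      rw [show 3 * γ - 2 * β = -β + -β + γ + γ + γ by ring, Real.rpow_add hTt, Real.rpow_add hTt,
        Real.rpow_add hTt, Real.rpow_add hTt]
      ring
    calc ENNReal.ofReal (c ^ 5 * (T - t) ^ (3 * γ - 2 * β)) * V₁
        = ENNReal.ofReal ((c * (T - t) ^ (-β)) ^ 2) * volume (ball x₀ (c * (T - t) ^ γ)) := by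
          rw [e, ENNReal.ofReal_mul (sq_nonneg _), hvol, mul_assoc]
      _ = ∫⁻ _ in ball x₀ (c * (T - t) ^ γ), ENNReal.ofReal ((c * (T - t) ^ (-β)) ^ 2) :=
          (setLIntegral_const _ _).symm
      _ ≤ ∫⁻ y in ball x₀ (c * (T - t) ^ γ), ‖u t y‖ₑ ^ 2 := by
          refine setLIntegral_mono' measurableSet_ball fun y hy => ?_
          rw [ENNReal.ofReal_pow hM, ← ofReal_norm]
          exact pow_le_pow_left' (ENNReal.ofReal_le_ofReal (hcore t ht y hy)) 2
      _ ≤ eEnergy (u t) := setLIntegral_le_lintegral _ _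
  -- for `t` close to `T` the lower bound exceeds `C`: pick `t₁ ∈ [t₀, T)` with
  -- `c⁵ (T - t)^{3γ-2β} V₁ > C` for all `t ∈ (t₁, T)`
  have hV₁r : 0 < V₁.toReal := ENNReal.toReal_pos hV₁0 hV₁top
  obtain ⟨s₁, hs₁0, hs₁⟩ : ∃ s₁ : ℝ, 0 < s₁ ∧ ∀ s : ℝ, 0 < s → s < s₁ →
      ((C : ℝ) + 1) / V₁.toReal < c ^ 5 * s ^ (3 * γ - 2 * β) := by
    -- `s ↦ s^{3γ-2β}` tends to `+∞` at `0⁺` since the exponent is negative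
    have hneg : 3 * γ - 2 * β < 0 := by linarith
    have htend : Tendsto (fun s : ℝ => c ^ 5 * s ^ (3 * γ - 2 * β)) (𝓝[>] 0) atTop :=
      (tendsto_rpow_neg_nhdsGT_zero hneg).const_mul_atTop (pow_pos hc 5)
    -- hmm: name of the lemma `x ^ y → ∞` as `x → 0⁺` for `y < 0`
    have hev := htend.eventually_gt_atTop (((C : ℝ) + 1) / V₁.toReal)
    rcases (nhdsGT_basis (0 : ℝ)).eventually_iff.1 hev with ⟨s₁, hs₁0, hs₁⟩
    exact ⟨s₁, hs₁0, fun s hs hss => hs₁ ⟨hs, by simpa using hss⟩⟩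
  set t₁ : ℝ := max t₀ (T - s₁) with ht₁
  have ht₁T : t₁ < T := max_lt ht₀T (by linarith)
  -- on `(t₁, T)`: a.e. `eEnergy ≤ C` but everywhere `eEnergy > C`
  have hae : ∀ᵐ t ∂(volume.restrict (Ioo t₁ T)), eEnergy (u t) ≤ C :=
    ae_restrict_of_ae_restrict_of_subset (Ioo_subset_Ioo_left (ht₀.trans (le_max_left _ _))) hCae
  have hne : NeBot (ae (volume.restrict (Ioo t₁ T))) := by
    rw [ae_neBot, Ne, Measure.restrict_eq_zero, Real.volume_Ioo, ENNReal.ofReal_eq_zero, not_le]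
    linarith
  obtain ⟨t, htC, ht⟩ := (hae.and (ae_restrict_mem measurableSet_Ioo)).exists
  have htIco : t ∈ Ico t₀ T := ⟨(le_max_left _ _).trans ht.1.le, ht.2⟩
  have hsT : T - t < s₁ := by
    have : T - s₁ ≤ t₁ := le_max_right _ _
    linarith [ht.1]
  have hgt : ((C : ℝ) + 1) / V₁.toReal < c ^ 5 * (T - t) ^ (3 * γ - 2 * β) :=
    hs₁ (T - t) (sub_pos.2 ht.2) hsT
  have hchain := (hlow t htIco).trans htC
  -- `ofReal (c⁵ (T-t)^{…}) * V₁ ≤ C` contradicts `hgt`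
  have hreal : c ^ 5 * (T - t) ^ (3 * γ - 2 * β) * V₁.toReal ≤ (C : ℝ) := by
    have h1 : ENNReal.ofReal (c ^ 5 * (T - t) ^ (3 * γ - 2 * β) * V₁.toReal) ≤ (C : ℝ≥0∞) := by
      rwa [ENNReal.ofReal_mul' ENNReal.toReal_nonneg, ENNReal.ofReal_toReal hV₁top]
    have h2 := ENNReal.toReal_mono ENNReal.coe_ne_top h1
    have hnn : 0 ≤ c ^ 5 * (T - t) ^ (3 * γ - 2 * β) * V₁.toReal :=
      mul_nonneg (mul_nonneg (pow_nonneg hc.le 5) (Real.rpow_nonneg (sub_pos.2 ht.2).le _))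
        ENNReal.toReal_nonneg
    rwa [ENNReal.toReal_ofReal hnn, ENNReal.coe_toReal] at h2
  have hgt' : (C : ℝ) + 1 < c ^ 5 * (T - t) ^ (3 * γ - 2 * β) * V₁.toReal := by
    rwa [div_lt_iff₀ hV₁r] at hgt
  linarith

/-- Hence **on the side `3γ ≤ 2β` only the energy-critical line `γ = 2β/3` carries cores.**
[folklore] -/
theorem three_mul_eq_two_mul_of_energyCore {T ν : ℝ}
    {u₀ : EuclideanSpace ℝ (Fin 3) → EuclideanSpace ℝ (Fin 3)}
    {u : ℝ → EuclideanSpace ℝ (Fin 3) → EuclideanSpace ℝ (Fin 3)} (hLH : IsLerayHopfOn T ν 0 u₀ u)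
    {β γ c t₀ : ℝ} {x₀ : EuclideanSpace ℝ (Fin 3)} (hc : 0 < c) (ht₀ : 0 ≤ t₀) (ht₀T : t₀ < T)
    (hβγ : 3 * γ ≤ 2 * β)
    (hcore : ∀ t ∈ Ico t₀ T, ∀ y ∈ ball x₀ (c * (T - t) ^ γ), c * (T - t) ^ (-β) ≤ ‖u t y‖) :
    3 * γ = 2 * β :=
  le_antisymm hβγ (two_mul_le_three_mul_of_energyCore hLH hc ht₀ ht₀T hcore)

end Summit.NavierStokesRegularity.NavierStokesRegularity.Theorems.TypeIliouvilleNoTypeIINegative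

end
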